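import Literature.AlgebraicGeometry.Resolution.BlowupSequencesExtensions
import Literature.AlgebraicGeometry.Resolution.BlowupSequencesRestrictMarked
import HarnessLib

/-!
# The induced sequence `φ^*(X_i)` along an étale morphism is a resolution of `φ^*(X, 𝓘, E, μ)` (BGMW 2011, Thm. 8.0.5)

Topic: `Literature/AlgebraicGeometry/Resolution`. Bierstone–Grigoriev–Milman–Włodarczyk,
arXiv:1206.3090, Thm. 4.0.6 / Thm. 8.0.5 (pp. 11, 23, arXiv numbering):

  "(1) For any surjective étale morphism `φ : X' → X`, the induced sequence `(X'_i) = φ^*(X_i)`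
  is the canonical resolution of `(X', 𝓘', E', μ) := φ^*(X, 𝓘, E, μ)`. (2) For any étale
  morphism `φ : M' → M`, the induced sequence `(X'_i) = φ^*(X_i)` is an extension of the
  canonical resolution of `(X', 𝓘', E', μ) := φ^*(X, 𝓘, E, μ)`."

Both clauses compare resolutions of `φ^*(X, 𝓘, E, μ)` with the induced sequence, which is
therefore itself a multiple blow-up / resolution of `φ^*(X, 𝓘, E, μ)`. For the data-level
induced sequence `CentreSeq.comap s φ` and the pulled-back marked ideal `MarkedIdeal.comap`
(`BlowupSequencesExtensions.lean`) this file PROVES exactly that, over the one-step transport of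
`MarkedIdealsEtale.lean`:

* `blowup.isPullback_comapMap` — **Görtz–Wedhorn I, Prop. 13.91 (2)**: for `f` flat the square
  `(Bl(f), π_U, π_X, f)` is cartesian, `Bl_{f^*C}(U) = Bl_C(X) ×_X U` (blow-ups commute with flat
  base change, `IsBlowup.pullback_snd_of_flat`, and uniqueness of blow-ups / of morphisms of
  blow-ups over `f`); `blowup.comapMap_mem` — `Bl(f)` inherits every base-change-stable property
  of the flat `f` (flat, unramified, locally of finite type, étale, smooth, surjective, …).
* `CentreSeq.comapι s f : (s^*f)_r ⟶ X_r` — the comparison morphism from the top of the induced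
  sequence (DEFINITION, by recursion), `comap_comp_ι` (it lies over `f`), `comapι_mem`
  (inherits base-change-stable properties `≤ Flat`), `isPullback_comap` (**the induced sequence
  is the fibre product**: `(s^*f)_r = X_r ×_X U` for `f` flat).
* `MarkedIdeal.support_comap_of_etale'`, `MarkedIdeal.transform_comap_of_flat'` — the one-step
  statements of `MarkedIdealsEtale.lean` in the packaging `MarkedIdeal.comap`.
* `CentreSeq.transformMarked_comap` — **transforms commute with the induced sequence**:
  `(s^*f)`-transforms of `f^*(X, 𝓘, E, μ)` are the pull-backs along `comapι` of the
  `s`-transforms (`f` flat, `X`, `U` locally Noetherian).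
* `CentreSeq.IsAdmissibleFor.comap_of_etale`, **`CentreSeq.IsResolutionOf.comap_of_etale`** —
  for `φ` flat, unramified and locally of finite type (e.g. `Etale φ`) and `X` locally
  Noetherian: **if `s` is a multiple blow-up (resp. a resolution) of `(X, 𝓘, E, μ)` then the
  induced sequence `s^*φ` is a multiple blow-up (resp. a resolution) of `φ^*(X, 𝓘, E, μ)`**
  (BGMW Def. 3.1.3 (1)–(6) transported: regular centres, centres in the support, simple normal
  crossings, controlled/strict transforms, empty final support).

## Sources

* [BGMW 2011] arXiv:1206.3090: Def. 3.1.3 (p. 6), Thm. 4.0.6 (1)–(2) (p. 11), Thm. 8.0.5 (1)–(2)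
  (p. 23). [BierstoneGrigorievMilmanWlodarczyk2011]
* U. Görtz, T. Wedhorn, *Algebraic Geometry I*, 2nd ed. (2020), Prop. 13.91 (1)–(2).
  [GortzWedhorn2020]
-/

noncomputable section

open CategoryTheory CategoryTheory.Limits AlgebraicGeometry TopologicalSpace

namespace Literature.AlgebraicGeometry.Resolution

universe u

/-! ## `Bl_{f^*C}(U) = Bl_C(X) ×_X U` for `f` flat (GW Prop. 13.91 (2)) -/

section ComapMap

variable {X U : Scheme.{u}}

/-- **Görtz–Wedhorn I, Prop. 13.91 (2)**: for a flat morphism `f : U ⟶ X` the square formed by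
the induced morphism `Bl(f) : Bl_{f^*C}(U) ⟶ Bl_C(X)`, the two blow-up morphisms and `f` is
cartesian. Proof: `Bl_C(X) ×_X U ⟶ U` is a blow-up of `U` along `f^*C`
(`IsBlowup.pullback_snd_of_flat`), hence isomorphic to `Bl_{f^*C}(U)` over `U`, and under this
isomorphism the first projection is `Bl(f)` (uniqueness of morphisms of blow-ups over `f`,
`blowup.hom_ext_over`). [cite: GortzWedhorn2020, Prop. 13.91 (2)] -/
theorem blowup.isPullback_comapMap (C : X.IdealSheafData) (f : U ⟶ X) [Flat f] :
    IsPullback (blowup.comapMap C f) (blowup.π (C.comap f)) (blowup.π C) f := by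
  have h1 : IsBlowup (pullback.snd (blowup.π C) f) (C.comap f) :=
    (blowup.isBlowup C).pullback_snd_of_flat f
  obtain ⟨e, he, -⟩ := (blowup.isBlowup (C.comap f)).unique h1
  have hfst : e.hom ≫ pullback.fst (blowup.π C) f = blowup.comapMap C f :=
    blowup.hom_ext_over rfl (by rw [Category.assoc, pullback.condition, reassoc_of% he])
      (blowup.comapMap_π C f)
  exact IsPullback.of_iso_pullback ⟨blowup.comapMap_π C f⟩ e hfst he

/-- Over a flat `f`, the induced morphism `Bl(f)` of blow-ups has every property of `f` that is
stable under base change (it is a base change of `f`, `blowup.isPullback_comapMap`): flat,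
unramified, locally of finite type, étale, smooth, surjective, an open immersion, ….
[cite: GortzWedhorn2020, Prop. 13.91 (2)] -/
theorem blowup.comapMap_mem (P : MorphismProperty Scheme.{u}) [P.IsStableUnderBaseChange]
    (C : X.IdealSheafData) (f : U ⟶ X) [Flat f] (hf : P f) : P (blowup.comapMap C f) :=
  MorphismProperty.of_isPullback (blowup.isPullback_comapMap C f).flip hf

end ComapMap

/-! ## The one-step transport in the packaging `MarkedIdeal.comap` -/

namespace MarkedIdeal

/-- **`supp(φ^*(X, 𝓘, E, μ)) = φ⁻¹ supp(X, 𝓘, E, μ)`** for `φ` flat, unramified and locally of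
finite type (e.g. étale) — `MarkedIdeal.support_comap_of_etale` for `MarkedIdeal.comap`.
[cite: BierstoneGrigorievMilmanWlodarczyk2011, Thm. 8.0.5 with Def. 3.1.2] -/
theorem support_comap_of_etale' {X' X : Scheme.{u}} (φ : X' ⟶ X) [Flat φ] [FormallyUnramified φ]
    [LocallyOfFiniteType φ] (M : MarkedIdeal X) : (M.comap φ).support = φ ⁻¹' M.support :=
  MarkedIdeal.support_comap_of_etale φ M _

/-- **The transform of the pulled-back marked ideal is the pull-back of the transform** along a
commutative square `s ≫ π = π' ≫ t` with `s` flat (`MarkedIdeal.transform_comap_of_flat` for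
`MarkedIdeal.comap`): `(t^*M).transform π' (t^*C) = s^*(M.transform π C)`.
[cite: BierstoneGrigorievMilmanWlodarczyk2011, Def. 3.1.3 (3)–(5) with Thm. 8.0.5] -/
theorem transform_comap_of_flat' {Y' Y Z' Z : Scheme.{u}} (t : Y' ⟶ Y) {π : Z ⟶ Y} {π' : Z' ⟶ Y'}
    {s : Z' ⟶ Z} [Flat s] [IsLocallyNoetherian Z] [IsLocallyNoetherian Z'] (hsq : s ≫ π = π' ≫ t)
    (M : MarkedIdeal Y) (C : Y.IdealSheafData) :
    (M.comap t).transform π' (C.comap t) = (M.transform π C).comap s :=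
  MarkedIdeal.transform_comap_of_flat t hsq M C

end MarkedIdeal

namespace CentreSeq

variable {X U : Scheme.{u}}

/-! ## The comparison morphism `(s^*f)_r ⟶ X_r` and the fibre-product property -/

/-- **The comparison morphism `(s^*f)_r ⟶ X_r`** from the top of the induced sequence `s^*f`
(`CentreSeq.comap`) to the top of `s`: `f` itself for the empty sequence, and recursively the
comparison morphism of the tails along `Bl(f)`. For an open immersion this is
`CentreSeq.restrictι`. [cite: BierstoneGrigorievMilmanWlodarczyk2011, Thm. 8.0.5 (1)–(2)] -/
def comapι : {X U : Scheme.{u}} → (s : CentreSeq X) → (f : U ⟶ X) → ((s.comap f).top ⟶ s.top)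
  | _, _, nil _, f => f
  | _, _, cons C rest, f => comapι rest (blowup.comapMap C f)

/-- Unfolding. [folklore] -/
@[simp] theorem comapι_nil (X : Scheme.{u}) (f : U ⟶ X) : (nil X).comapι f = f := rfl

/-- Unfolding. [folklore] -/
@[simp] theorem comapι_cons (C : X.IdealSheafData) (rest : CentreSeq (blowup C)) (f : U ⟶ X) :
    (cons C rest).comapι f = rest.comapι (blowup.comapMap C f) := rfl

/-- The induced sequence lies over the original one: `(s^*f)_r → U → X = (s^*f)_r → X_r → X`.
[folklore] -/
theorem comap_comp_ι : ∀ {X U : Scheme.{u}} (s : CentreSeq X) (f : U ⟶ X),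
    (s.comap f).comp ≫ f = s.comapι f ≫ s.comp
  | X, U, nil _, f => show 𝟙 U ≫ f = f ≫ 𝟙 X by simp
  | _, _, cons C rest, f => by
    show ((rest.comap (blowup.comapMap C f)).comp ≫ blowup.π (C.comap f)) ≫ f =
      comapι rest (blowup.comapMap C f) ≫ rest.comp ≫ blowup.π C
    rw [← reassoc_of% (comap_comp_ι rest (blowup.comapMap C f)), blowup.comapMap_π,
      Category.assoc]

/-- The comparison morphism inherits from a flat `f` every property `P ≤ Flat` stable under base
change (flat; flat and unramified; étale; smooth; open immersion; …), stage by stage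
(`blowup.comapMap_mem`). [folklore] -/
theorem comapι_mem (P : MorphismProperty Scheme.{u}) [P.IsStableUnderBaseChange]
    (hP : ∀ {V W : Scheme.{u}} (g : V ⟶ W), P g → Flat g) :
    ∀ {X U : Scheme.{u}} (s : CentreSeq X) (f : U ⟶ X), P f → P (s.comapι f)
  | _, _, nil _, _, hf => hf
  | _, _, cons C rest, f, hf => by
    haveI : Flat f := hP f hf
    exact comapι_mem P hP rest (blowup.comapMap C f) (blowup.comapMap_mem P C f hf)

/-- The comparison morphism of the induced sequence along a flat `f` is flat. [folklore] -/
theorem flat_comapι {X U : Scheme.{u}} (s : CentreSeq X) (f : U ⟶ X) [Flat f] :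
    Flat (s.comapι f) :=
  comapι_mem @Flat (fun _ h => h) s f ‹Flat f›

/-- **The induced sequence along a flat morphism is the fibre product**: the square
`((s^*f)_r → X_r, (s^*f)_r → U, X_r → X, U → X)` is cartesian (GW Prop. 13.91 (2) stage by
stage, `IsPullback.paste_vert`). [cite: GortzWedhorn2020, Prop. 13.91 (2)] -/
theorem isPullback_comap : ∀ {X U : Scheme.{u}} (s : CentreSeq X) (f : U ⟶ X) [Flat f],
    IsPullback (s.comapι f) (s.comap f).comp s.comp f
  | X, U, nil _, f, _ =>
    show IsPullback f (𝟙 U) (𝟙 X) f from IsPullback.of_vert_isIso ⟨by simp⟩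
  | _, _, cons C rest, f, _ => by
    haveI : Flat (blowup.comapMap C f) := blowup.comapMap_mem @Flat C f ‹_›
    show IsPullback (comapι rest (blowup.comapMap C f))
      ((rest.comap (blowup.comapMap C f)).comp ≫ blowup.π (C.comap f)) (rest.comp ≫ blowup.π C) f
    exact (isPullback_comap rest (blowup.comapMap C f)).paste_vert (blowup.isPullback_comapMap C f)

/-! ## Transforms, admissibility and resolutions along the induced sequence -/

/-- **Transforms commute with the induced sequence** (BGMW Def. 3.1.3 (3)–(5) along `s^*f`): for
`f : U ⟶ X` flat between locally Noetherian schemes, the transforms of `f^*(X, 𝓘, E, μ)` along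
`s^*f` are the pull-backs along the (flat) comparison morphisms `(s^*f)_r ⟶ X_r` of the transforms
of `(X, 𝓘, E, μ)` along `s` (one step: `MarkedIdeal.transform_comap_of_flat'` for the cartesian
square `blowup.isPullback_comapMap`).
[cite: BierstoneGrigorievMilmanWlodarczyk2011, Def. 3.1.3 (3)–(5) with Thm. 8.0.5] -/
theorem transformMarked_comap : ∀ {X U : Scheme.{u}} [IsLocallyNoetherian X] [IsLocallyNoetherian U]
    (s : CentreSeq X) (f : U ⟶ X) [Flat f] (M : MarkedIdeal X),
    (s.comap f).transformMarked (M.comap f) = (s.transformMarked M).comap (s.comapι f)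
  | _, _, _, _, nil _, _, _, _ => rfl
  | X, U, _, _, cons C rest, f, _, M => by
    haveI : IsLocallyNoetherian (blowup C) := isLocallyNoetherian_blowup C
    haveI : IsLocallyNoetherian (blowup (C.comap f)) := isLocallyNoetherian_blowup (C.comap f)
    haveI : Flat (blowup.comapMap C f) := blowup.comapMap_mem @Flat C f ‹_›
    have e := MarkedIdeal.transform_comap_of_flat' f (s := blowup.comapMap C f) (π := blowup.π C)
      (π' := blowup.π (C.comap f)) (blowup.comapMap_π C f) M C
    show (rest.comap (blowup.comapMap C f)).transformMarked
        ((M.comap f).transform (blowup.π (C.comap f)) (C.comap f)) = _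
    rw [e]
    exact transformMarked_comap rest (blowup.comapMap C f) (M.transform (blowup.π C) C)

/-- **Admissibility is preserved along the induced sequence** (BGMW Def. 3.1.3 (1)–(2) for
`φ^*(X_i)`, `φ` flat, unramified and locally of finite type, e.g. étale): the pulled-back centres
are regular (`Scheme.IsRegular.subscheme_comap_of_etale`), lie in the supports of the
transforms of `φ^*(X, 𝓘, E, μ)` (`MarkedIdeal.support_comap_of_etale'`) and have simple normal
crossings with their boundaries (`HasSNCWith.comap_of_etale`).
[cite: BierstoneGrigorievMilmanWlodarczyk2011, Def. 3.1.3 (1)–(2) with Thm. 8.0.5 (1)–(2)] -/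
theorem IsAdmissibleFor.comap_of_etale : ∀ {X U : Scheme.{u}} [IsLocallyNoetherian X]
    (s : CentreSeq X) (φ : U ⟶ X) [Flat φ] [FormallyUnramified φ] [LocallyOfFiniteType φ]
    (M : MarkedIdeal X), s.IsAdmissibleFor M → (s.comap φ).IsAdmissibleFor (M.comap φ)
  | _, _, _, nil _, _, _, _, _, _, _ => trivial
  | X, U, _, cons C rest, φ, _, _, _, M, h => by
    haveI : IsLocallyNoetherian U := LocallyOfFiniteType.isLocallyNoetherian φ
    haveI : IsLocallyNoetherian (blowup C) := isLocallyNoetherian_blowup C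
    haveI : IsLocallyNoetherian (blowup (C.comap φ)) := isLocallyNoetherian_blowup (C.comap φ)
    haveI : Flat (blowup.comapMap C φ) := blowup.comapMap_mem @Flat C φ ‹_›
    haveI : FormallyUnramified (blowup.comapMap C φ) :=
      blowup.comapMap_mem @FormallyUnramified C φ ‹_›
    haveI : LocallyOfFiniteType (blowup.comapMap C φ) :=
      blowup.comapMap_mem @LocallyOfFiniteType C φ ‹_›
    obtain ⟨hsupp, hsnc, hC, hrest⟩ := h
    refine (isAdmissibleFor_cons (C.comap φ) _ _).mpr ⟨?_, hsnc.comap_of_etale φ,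
      Scheme.IsRegular.subscheme_comap_of_etale φ C hC, ?_⟩
    · intro u hu
      rw [Scheme.IdealSheafData.support_comap] at hu
      rw [MarkedIdeal.support_comap_of_etale']
      exact hsupp hu
    · have e := MarkedIdeal.transform_comap_of_flat' φ (s := blowup.comapMap C φ)
        (π := blowup.π C) (π' := blowup.π (C.comap φ)) (blowup.comapMap_π C φ) M C
      change (rest.comap (blowup.comapMap C φ)).IsAdmissibleFor
        ((M.comap φ).transform (blowup.π (C.comap φ)) (C.comap φ))
      rw [e]
      exact IsAdmissibleFor.comap_of_etale rest (blowup.comapMap C φ) (M.transform (blowup.π C) C)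
        hrest

/-- **The induced sequence `φ^*(X_i)` of a resolution is a resolution of `φ^*(X, 𝓘, E, μ)`**
(BGMW Thm. 8.0.5 (1)–(2) with Def. 3.1.3: the statement underlying "`φ^*(X_i)` is [an extension
of] the canonical resolution of `φ^*(X, 𝓘, E, μ)`"), for `φ` flat, unramified and locally of
finite type (e.g. étale) and `X` locally Noetherian: admissibility is preserved
(`IsAdmissibleFor.comap_of_etale`) and the final support is the preimage of the empty final
support under the comparison morphism `(s^*φ)_r ⟶ X_r`, itself flat, unramified and locally of
finite type (`transformMarked_comap`, `MarkedIdeal.support_comap_of_etale'`).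
[cite: BierstoneGrigorievMilmanWlodarczyk2011, Thm. 8.0.5 (1)–(2) with Def. 3.1.3] -/
theorem IsResolutionOf.comap_of_etale {X U : Scheme.{u}} [IsLocallyNoetherian X] {s : CentreSeq X}
    {M : MarkedIdeal X} (h : s.IsResolutionOf M) (φ : U ⟶ X) [Flat φ] [FormallyUnramified φ]
    [LocallyOfFiniteType φ] : (s.comap φ).IsResolutionOf (M.comap φ) := by
  haveI : IsLocallyNoetherian U := LocallyOfFiniteType.isLocallyNoetherian φ
  refine ⟨IsAdmissibleFor.comap_of_etale s φ M h.1, ?_⟩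
  haveI : Flat (s.comapι φ) := flat_comapι s φ
  haveI : FormallyUnramified (s.comapι φ) :=
    comapι_mem (@FormallyUnramified ⊓ @Flat) (fun _ h => h.2) s φ ⟨‹_›, ‹_›⟩ |>.1
  haveI : LocallyOfFiniteType (s.comapι φ) :=
    comapι_mem (@LocallyOfFiniteType ⊓ @Flat) (fun _ h => h.2) s φ ⟨‹_›, ‹_›⟩ |>.1
  rw [transformMarked_comap, MarkedIdeal.support_comap_of_etale', h.2, Set.preimage_empty]

end CentreSeq

end Literature.AlgebraicGeometry.Resolution
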